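/-
Copyright (c) 2026 the pub-hodgecm-mathlib formalisation cell (harness21).  Prover seat hodgecm-mathlib-K2E4-p10 (g0), Track B ∕ K2-LIT
(build stream 29), h413 = `stmt-HodgeConjecture-24833`, line `K2_E4_SingularTransferKappaSign`, socket module «ArchLimitConstant», file #10
`sig_K2E4ExplicitArchConstantPhase` — helper §B (the phase of `Δ‴_∞` and its value at the semiregular pair).  2026-09-03.
-/
import Literature.NumberTheory.Rogawski1990.ArchExplicitTransferFactorGHRegular        -- ★ `archCanonicalDelta_ne_zero_of_isUnit_eval` (`Δ‴_∞ ≠ 0` at `(G,H)`-regular local pairs)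
import Literature.NumberTheory.Rogawski1990.ArchExplicitTransferFactorCentralCurveTau  -- ★ `norm_archHeckeValue_eq_one_of_isUnit` (`‖μ_∞(x)‖ = 1`)
import Literature.NumberTheory.Rogawski1990.ArchExplicitTransferFactorScalarPartner    -- ★ `isUnit_eval_archCharpolyTwo_rationalArch_iff_of_fst_eq_smul_one` (`χ_g(u) ⊗ 1` a unit)
import Literature.NumberTheory.Rogawski1990.AdelicStableConjugacyG2                    -- ★ `IsNormPair.isArchNormPair_cmRationalToArch` (`γ_H ⊗ 1 ↔ γ₀ ⊗ 1`)
import Literature.NumberTheory.Rogawski1990.SingularStableClassTransfers               -- ★ `endoMatches_iff_of_mul_sub_eq_zero` (the semiregular pair matches)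
import HarnessLib

/-!
# Socket #10 `sig_K2E4ExplicitArchConstantPhase`, helper §B: the PHASE of the archimedean factor of record `Δ‴_∞` —
# `conj Δ‴_∞(γ_H, γ′) · τ_∞(γ_H)² = Δ‴_∞(γ_H, γ′)`, `Δ‴_∞ ∈ τ_∞ · ℝ`, and `Δ‴_∞(γ_H ⊗ 1, γ₀ ⊗ 1) ≠ 0` at print's semiregular pair
# (Rogawski 1990 §4.9 p. 55, Prop. 8.2.1 proof pp. 118–119; §14.6 p. 242)

Cell `hodgecm-mathlib`, crux H413 = `stmt-HodgeConjecture-24833`, route `HCCMUnconditional`; Track B «K2-LIT», line `K2_E4_SingularTransferKappaSign`,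
socket `…SigsArchLimitConstant.sig_K2E4ExplicitArchConstantPhase` (U6, #10; `Tinf = archCanonicalTransferFactor L H′ μ`).  THEOREMS ONLY (no `def`, no instance,
no notation, no `sorry`); lane `--supports stmt-HodgeConjecture-24833`.

THE MATHEMATICS.  ★ `archCanonicalDelta_of_isArchNormPair`: on a matching pair `Δ‴_∞(γ_H, γ′) = τ_∞(γ_H) · D_{G∕H,∞}(γ_H) · Π_w κ‴_w` with `D ∈ ℝ`, `κ‴_w ∈ ℤ`,
and `τ_∞ = μ_∞(γ₂)·μ_∞(−χ_g(γ₂)∕det g)⁻¹` (★ `archTau`), a product of values of the UNITARY character `μ_∞` (or `0` when `χ_g(γ₂)` is not a unit).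
Hence (§1) `conj τ_∞ · τ_∞² = τ_∞`, (§2) `conj Δ‴_∞ · τ_∞² = Δ‴_∞` and `Δ‴_∞ = τ_∞ · r` with `r` real — the two identities behind the conjugation
symmetry of the `Δ‴_∞`-transfer — and (§3) at print's semiregular pair `γ_H = (e₁·1₂, e₂)`, `(γ₀ − e₁)(γ₀ − e₂) = 0`, `charpoly γ₀ = (X − e₁)²(X − e₂)`, `e₁ ≠ e₂`
[Prop. 8.2.1 p. 118]: `γ_H → γ₀` (★ `endoMatches_iff_of_mul_sub_eq_zero`), `χ_g(e₂) ⊗ 1 = (e₂ − e₁)² ⊗ 1` is a unit, so `Δ‴_∞(γ_H ⊗ 1, γ₀ ⊗ 1) ≠ 0`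
(★ `archCanonicalDelta_ne_zero_of_isUnit_eval`: «there is a non-zero constant c» [p. 119, L3], «τ(γ)|A₁(γ)A₂(γ)|» [L36]).

* §1 `conj_archHeckeValue_mul_self`, `conj_archTau_mul_archTau_sq` (`μ` unitary).
* §2 `conj_archCanonicalDelta_mul_archTau_sq`, `exists_archCanonicalDelta_eq_archTau_mul_ofReal`.
* §3 `isNormPair_of_semiregular`, `isArchNormPair_of_semiregular`, `isUnit_eval_archCharpolyTwo_of_semiregular`, `archCanonicalDelta_ne_zero_of_semiregular`.
EDITION 2 (docstring-only page folds per lit1 (5162) `lit/D-CITE-REGISTRY.md` § K2-R90-PAGES: «Prop. 8.2.1 p. 117» → p. 118 (§8.2 = pp. 118–121), K2E4-38 «§3.8 p. 27» → pp. 30–31;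
Lean bytes of every declaration unchanged).
HONEST LABEL: count-neutral helper; HC_CM is proved only modulo the 7 printed citations (2 remaining named inputs: hLiu418 = stmt-HodgeConjecture-24832,
h413 = stmt-HodgeConjecture-24833) until rung 0 closes.

## References
* [Rogawski1990] J. D. Rogawski, *Automorphic Representations of Unitary Groups in Three Variables*, Ann. of Math. Stud. 123 (1990), §4.9 p. 55 (`τ`, `D_{G∕H}`),
  Prop. 8.2.1 p. 118 and its proof pp. 118–119, §14.6 p. 242.
* [TateThesis1967] J. Tate, *Fourier analysis in number fields and Hecke's zeta-functions*, in Cassels–Fröhlich (1967), §2.3, §4.3 (unitary characters).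
-/

set_option autoImplicit false
set_option linter.dupNamespace false

noncomputable section

open NumberField NumberField.InfinitePlace IsDedekindDomain Matrix Polynomial
open scoped ComplexConjugate MatrixGroups Classical

namespace Summit.HodgeConjecture.HodgeConjecture.Cruxes.H413.K2E4ExplicitArchConstantPhaseFactor

open Literature.NumberTheory.Automorphic Literature.NumberTheory.Rogawski1990 Literature.NumberTheory.GaloisRepresentations
open Literature.AlgebraicGeometry.ShimuraVarieties (unitaryGroup hermForm)

/-! ## §1 `μ_∞` unitary: `conj μ_∞(x) · μ_∞(x) = 1`, `conj τ_∞ · τ_∞² = τ_∞` -/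

section Unitary

variable (L : Type) [Field L] [NumberField L]

/-- **`conj μ_∞(x) · μ_∞(x) = 1`** at a unit `x ∈ L ⊗ ℝ`, for a UNITARY Hecke character (`‖μ_∞(x)‖ = 1`, ★ `norm_archHeckeValue_eq_one_of_isUnit`).
[cite: TateThesis1967, §2.3; §4.3] [cite: Rogawski1990, §4.9 p. 55] -/
theorem conj_archHeckeValue_mul_self {μ : HeckeCharacter L} (hμu : μ.IsUnitary) {x : mixedEmbedding.mixedSpace L} (hx : IsUnit x) :
    conj (archHeckeValue L μ x) * archHeckeValue L μ x = 1 := by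
  rw [Complex.conj_mul', norm_archHeckeValue_eq_one_of_isUnit L hμu hx]
  norm_num

variable [IsCMField L]
  (γH : ↥(UnitaryGroup.arch (↥(maximalRealSubfield L)) L (IsCMField.complexConj L) 2
      (Matrix.of fun i j : Fin 2 => if i.val + j.val + 1 = 2 then (1 : L) else 0)) ×
    ↥(UnitaryGroup.arch (↥(maximalRealSubfield L)) L (IsCMField.complexConj L) 1
      (Matrix.of fun i j : Fin 1 => if i.val + j.val + 1 = 1 then (1 : L) else 0)))

/-- **`conj τ_∞(γ_H) · τ_∞(γ_H)² = τ_∞(γ_H)`** for EVERY `γ_H ∈ H_∞` and unitary `μ`: either both arguments of `μ_∞` in `τ_∞ = μ_∞(γ₂)·μ_∞(·)⁻¹` are units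
(then `|τ_∞| = 1`) or `τ_∞ = 0`. [cite: Rogawski1990, §4.9 p. 55 («`|τ(γ)| = 1`»)] -/
theorem conj_archTau_mul_archTau_sq {μ : HeckeCharacter L} (hμu : μ.IsUnitary) :
    conj (archTau L γH μ) * archTau L γH μ ^ 2 = archTau L γH μ := by
  unfold archTau
  by_cases h1 : IsUnit (archGammaTwo L γH)
  · by_cases h2 : IsUnit (archTauArg L γH)
    · have e1 := conj_archHeckeValue_mul_self L hμu h1
      have e2 := conj_archHeckeValue_mul_self L hμu h2
      have hA : archHeckeValue L μ (archGammaTwo L γH) ≠ 0 := archHeckeValue_ne_zero_of_isUnit L μ h1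
      have hB : archHeckeValue L μ (archTauArg L γH) ≠ 0 := archHeckeValue_ne_zero_of_isUnit L μ h2
      rw [map_mul, map_inv₀, eq_inv_of_mul_eq_one_left e1, eq_inv_of_mul_eq_one_left e2, inv_inv]
      field_simp
    · rw [archHeckeValue_of_not_isUnit L μ h2, _root_.inv_zero, mul_zero, map_zero, zero_mul]
  · rw [archHeckeValue_of_not_isUnit L μ h1, zero_mul, map_zero, zero_mul]

end Unitary

/-! ## §2 The phase of `Δ‴_∞`: `conj Δ‴_∞ · τ_∞² = Δ‴_∞` and `Δ‴_∞ ∈ τ_∞ · ℝ` -/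

section Phase

variable (L : Type) [Field L] [NumberField L] [IsCMField L] (H' : Matrix (Fin 3) (Fin 3) L) (μ : HeckeCharacter L)
  (γH : ↥(UnitaryGroup.arch (↥(maximalRealSubfield L)) L (IsCMField.complexConj L) 2
      (Matrix.of fun i j : Fin 2 => if i.val + j.val + 1 = 2 then (1 : L) else 0)) ×
    ↥(UnitaryGroup.arch (↥(maximalRealSubfield L)) L (IsCMField.complexConj L) 1
      (Matrix.of fun i j : Fin 1 => if i.val + j.val + 1 = 1 then (1 : L) else 0)))
  (γ' : ↥(UnitaryGroup.arch (↥(maximalRealSubfield L)) L (IsCMField.complexConj L) 3 H'))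

/-- **`Δ‴_∞(γ_H, γ′) = τ_∞(γ_H) · r` with `r ∈ ℝ`** (`r = D_{G∕H,∞} · Π_w κ‴_w` on a matching pair, `r = 0` off the matching pairs).
[cite: Rogawski1990, §4.9 p. 55; §14.6 p. 242] -/
theorem exists_archCanonicalDelta_eq_archTau_mul_ofReal :
    ∃ r : ℝ, (archCanonicalTransferFactor L H' μ).Δ γH γ' = archTau L γH μ * (r : ℂ) := by
  change ∃ r : ℝ, archCanonicalDelta L H' γH μ γ' = archTau L γH μ * (r : ℂ)
  by_cases hp : IsArchNormPair L H' γH γ'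
  · refine ⟨archWeylRatio L γH * ((∏ w : {w : InfinitePlace L // IsComplex w}, archKappaSignAt L H' γH w γ' : ℤ) : ℝ), ?_⟩
    rw [archCanonicalDelta_of_isArchNormPair L H' γH μ hp, Complex.ofReal_mul, Complex.ofReal_intCast, mul_assoc]
  · exact ⟨0, by rw [archCanonicalDelta_of_not_isArchNormPair L H' γH μ hp, Complex.ofReal_zero, mul_zero]⟩

/-- **`conj Δ‴_∞(γ_H, γ′) · τ_∞(γ_H)² = Δ‴_∞(γ_H, γ′)`** for unitary `μ` — the identity that makes the complex conjugate of a `Δ‴_∞`-transfer pair a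
`Δ‴_∞`-transfer pair up to the class function `τ_∞²`. [cite: Rogawski1990, §4.9 p. 55; Prop. 8.2.1 proof pp. 118–119] -/
theorem conj_archCanonicalDelta_mul_archTau_sq (hμu : μ.IsUnitary) :
    conj ((archCanonicalTransferFactor L H' μ).Δ γH γ') * archTau L γH μ ^ 2 = (archCanonicalTransferFactor L H' μ).Δ γH γ' := by
  obtain ⟨r, hr⟩ := exists_archCanonicalDelta_eq_archTau_mul_ofReal L H' μ γH γ'
  rw [hr, map_mul, Complex.conj_ofReal, mul_right_comm, conj_archTau_mul_archTau_sq L γH hμu]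

end Phase

/-! ## §3 Print's semiregular pair `γ_H = (e₁·1₂, e₂)`, `γ₀` with `charpoly γ₀ = (X − e₁)²(X − e₂)`, `e₁ ≠ e₂` -/

section Semiregular

variable (L : Type) [Field L] [NumberField L] [IsCMField L] (H' : Matrix (Fin 3) (Fin 3) L)
  {γ₀ : (UnitaryGroup.cmDatum L 3 H').Rational} {e₁ e₂ : L} (hne : e₁ ≠ e₂)
  (hγ : ((((γ₀ : unitaryGroup (cmConjRingHom L) H').val : GL (Fin 3) L) : Matrix (Fin 3) (Fin 3) L) - e₁ • (1 : Matrix (Fin 3) (Fin 3) L)) *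
    ((((γ₀ : unitaryGroup (cmConjRingHom L) H').val : GL (Fin 3) L) : Matrix (Fin 3) (Fin 3) L) - e₂ • (1 : Matrix (Fin 3) (Fin 3) L)) = 0)
  (hchar : (((γ₀ : unitaryGroup (cmConjRingHom L) H').val : GL (Fin 3) L) : Matrix (Fin 3) (Fin 3) L).charpoly =
    (Polynomial.X - Polynomial.C e₁) ^ 2 * (Polynomial.X - Polynomial.C e₂))
  {γH : (UnitaryGroup.cmDatum L 2 (Matrix.of fun i j : Fin 2 => if i.val + j.val + 1 = 2 then (1 : L) else 0)).Rational ×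
    (UnitaryGroup.cmDatum L 1 (Matrix.of fun i j : Fin 1 => if i.val + j.val + 1 = 1 then (1 : L) else 0)).Rational}
  (h1 : (((γH.1 : unitaryGroup (cmConjRingHom L) (Matrix.of fun i j : Fin 2 => if i.val + j.val + 1 = 2 then (1 : L) else 0)).val : GL (Fin 2) L) :
      Matrix (Fin 2) (Fin 2) L) = e₁ • (1 : Matrix (Fin 2) (Fin 2) L))
  (h2 : (((γH.2 : unitaryGroup (cmConjRingHom L) (Matrix.of fun i j : Fin 1 => if i.val + j.val + 1 = 1 then (1 : L) else 0)).val : GL (Fin 1) L) :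
      Matrix (Fin 1) (Fin 1) L) 0 0 = e₂)

include h2 in
/-- The `U(Φ₁)`-block of the partner is the scalar `e₂ · 1₁`. [cite: Rogawski1990, Prop. 8.2.1 p. 118] -/
theorem coe_snd_eq_smul_one_of_semiregular :
    (((γH.2 : unitaryGroup (cmConjRingHom L) (Matrix.of fun i j : Fin 1 => if i.val + j.val + 1 = 1 then (1 : L) else 0)).val : GL (Fin 1) L) :
      Matrix (Fin 1) (Fin 1) L) = e₂ • (1 : Matrix (Fin 1) (Fin 1) L) := by
  ext i j
  have hi : i = 0 := Subsingleton.elim _ _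
  have hj : j = 0 := Subsingleton.elim _ _
  subst hi hj
  rw [h2, Matrix.smul_apply, Matrix.one_apply_eq, smul_eq_mul, mul_one]

include hne hγ hchar h1 h2 in
/-- **`γ_H = (e₁·1₂, e₂) → γ₀`**: print's semiregular partner MATCHES `γ₀` (`ι(γ_H) = diag(e₁, e₂, e₁)` and `γ₀` are split semisimple with the same characteristic
polynomial, hence `GL₃(L)`-conjugate — ★ `endoMatches_iff_of_mul_sub_eq_zero`). [cite: Rogawski1990, Prop. 8.2.1 p. 118; §3.8 pp. 30–31] -/
theorem isNormPair_of_semiregular : IsNormPair L H' γH γ₀ := by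
  have h2' := coe_snd_eq_smul_one_of_semiregular L h2
  change EndoMatches (cmConjRingHom L) _ _ _ H' endoForm_antidiagOne γH γ₀
  rw [endoMatches_iff_of_mul_sub_eq_zero (cmConjRingHom L) endoForm_antidiagOne _ γ₀ hne hγ, hchar, h1, h2']
  refine ⟨⟨by rw [sub_self, Matrix.zero_mul], by rw [sub_self, Matrix.mul_zero]⟩, ?_⟩
  rw [Matrix.smul_one_eq_diagonal, Matrix.smul_one_eq_diagonal, Matrix.charpoly_diagonal, Matrix.charpoly_diagonal, Fin.prod_univ_two,
    Fin.prod_univ_one]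
  ring

include hne hγ hchar h1 h2 in
/-- **`γ_H ⊗ 1 ↔ γ₀ ⊗ 1` in `GL₃(L ⊗ ℝ)`** at the semiregular pair (★ `IsNormPair.isArchNormPair_cmRationalToArch`). [cite: Rogawski1990, Prop. 8.2.1 p. 118; §14.3 p. 234] -/
theorem isArchNormPair_of_semiregular :
    IsArchNormPair L H'
      (cmRationalToArch L 2 (Matrix.of fun i j : Fin 2 => if i.val + j.val + 1 = 2 then (1 : L) else 0) γH.1,
        cmRationalToArch L 1 (Matrix.of fun i j : Fin 1 => if i.val + j.val + 1 = 1 then (1 : L) else 0) γH.2)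
      (cmRationalToArch L 3 H' γ₀) :=
  (isNormPair_of_semiregular L H' hne hγ hchar h1 h2).isArchNormPair_cmRationalToArch

include hne h1 h2 in
/-- **`χ_g(γ₂)(γ_H ⊗ 1) = (e₂ − e₁)² ⊗ 1` is a unit of `L ⊗ ℝ`** (`e₁ ≠ e₂`; ★ `isUnit_eval_archCharpolyTwo_rationalArch_iff_of_fst_eq_smul_one`): the partner is
`(G,H)`-regular. [cite: Rogawski1990, Prop. 8.2.1 (a) p. 118 («τ(γ)|A₁(γ)A₂(γ)|»)] -/
theorem isUnit_eval_archCharpolyTwo_of_semiregular :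
    IsUnit ((archCharpolyTwo L
        (cmRationalToArch L 2 (Matrix.of fun i j : Fin 2 => if i.val + j.val + 1 = 2 then (1 : L) else 0) γH.1,
          cmRationalToArch L 1 (Matrix.of fun i j : Fin 1 => if i.val + j.val + 1 = 1 then (1 : L) else 0) γH.2)).eval
      (archGammaTwo L
        (cmRationalToArch L 2 (Matrix.of fun i j : Fin 2 => if i.val + j.val + 1 = 2 then (1 : L) else 0) γH.1,
          cmRationalToArch L 1 (Matrix.of fun i j : Fin 1 => if i.val + j.val + 1 = 1 then (1 : L) else 0) γH.2))) := by
  have h := (isUnit_eval_archCharpolyTwo_rationalArch_iff_of_fst_eq_smul_one L γH h1).2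
    (((sub_ne_zero.2 (fun h => hne (h.symm.trans h2))).isUnit).map (mixedEmbedding L))
  exact h

include hne hγ hchar h1 h2 in
/-- **`Δ‴_∞(γ_H ⊗ 1, γ₀ ⊗ 1) ≠ 0` AT PRINT'S SEMIREGULAR PAIR** (`H′` hermitian anisotropic; ★ `archCanonicalDelta_ne_zero_of_isUnit_eval`): the datum behind «there is a
non-zero constant c» of the archimedean limit formula. [cite: Rogawski1990, Prop. 8.2.1 proof p. 119; §14.5 Lemma 14.5.2 (b) proof p. 238] -/
theorem archCanonicalDelta_ne_zero_of_semiregular (μ : HeckeCharacter L) (hherm : (H'.map (cmConjRingHom L)).transpose = H')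
    (hanis : ∀ x : Fin 3 → L, hermForm (cmConjRingHom L) H' x x = 0 → x = 0) :
    (archCanonicalTransferFactor L H' μ).Δ
      (cmRationalToArch L 2 (Matrix.of fun i j : Fin 2 => if i.val + j.val + 1 = 2 then (1 : L) else 0) γH.1,
        cmRationalToArch L 1 (Matrix.of fun i j : Fin 1 => if i.val + j.val + 1 = 1 then (1 : L) else 0) γH.2)
      (cmRationalToArch L 3 H' γ₀) ≠ 0 :=
  archCanonicalDelta_ne_zero_of_isUnit_eval L H' _ _ μ hherm hanis (isArchNormPair_of_semiregular L H' hne hγ hchar h1 h2)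
    (isUnit_eval_archCharpolyTwo_of_semiregular L hne h1 h2)

end Semiregular

end Summit.HodgeConjecture.HodgeConjecture.Cruxes.H413.K2E4ExplicitArchConstantPhaseFactor

end
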